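import Literature.MathematicalPhysics.QuantumFieldTheory.Balaban1983to89.T4TwoRunUniqueness

/-!
# EriceRemainderEnclosureHistoryUniquenessColumn — (E32c) THE SIGN-FREE TWIN: node U2's own (column-summing) road to the uniqueness
# leg needs of the history modulus ONLY its COLUMN total weight `sup_i Σ_{j≥i} Λ j i ≤ M′` — no `FadingMemory`, no monotonicity of the
# runs, no sign; for an AGE PROFILE `Λ j i = ρ(j − i)` rows = columns = `Σ_a ρ(a)`, so a SUMMABLE profile (no rate) pays uniqueness

Cell `pub-balaban`, β-function sub-cell, BINDER row D4 «RemainderConst leaves for Bałaban's split» (`HOME/BINDER-OWNERS.md`; owner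
lineage `b2b-balaban-beta-an4`; this file by co-owner #2 lineage `b2b-balaban-beta-d4-p2`, generation 34), β-FLOW TEAM duty (1),
FREEZE (0) honoured (def-free; the lineage's `EriceRemainderEnclosure*` series).  Third file of station (E32); import-independent of
(E32) `EriceRemainderEnclosureHistoryUniqueness` (rows, the junction's currency, near-monotone runs) and (E32b) `…UniquenessSharp`
(the integer witness); imports node U2's `T4TwoRunUniqueness` only (`disc₀_step`, `sum_weights₀_le_of_eventualLower`, `eq_of_disc₀_eq_zero`
BY NAME).  Written on the OWNER's word W-an4-g84-1 (cell journal [AN4-G84-W1]): «the sign-free twin of U2's road is the COLUMN total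
weight sup_i Σ_{j≥i} Λ j i ≤ M′ (Σ_j Σ_{i≤j} Λ_{ji}·u_i·δ_i ≤ M′·U·max δ, no monotonicity) — NOT the junction's currency».

HONEST FRAMING (page 1, verbatim and binding).  *"Discharging BetaPertH makes Bałaban's UV stability UNCONDITIONAL — a real
constructive-QFT result; it is NOT the continuum limit and NOT the Clay problem."*  THIS FILE DISCHARGES NOTHING OF THE KIND.
«UNIQUENESS» = of the tuned bare coupling ∕ pin-Lipschitz of the matched history of the SCALAR recursion (0.20) at fixed cutoff (node U2's
sense).  Every β-side input is a NAMED BINDER on an abstract `β : FlowStep.HBeta`, NOT PRINTED for [I] (1.22): `T4CouplingMatching.HistLipschitz`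
(GAPS G-t4-U2-1∕-2), `EventualLowerH b γ k₀ β`.  Row D4 class UNCHANGED (critical-path width 0; instance 0∕1; D4 DISCHARGE NO DATE).
HONEST DEPENDENCY: continuum YM on T⁴ ⇐ BetaPertH ∧ nine spine estimates (0/9 proved); BetaPertH ⇐ (D1) ∧ (D4) ∧ CAP+tail; G-an2-4 gates
asym, D1 and NE2/3/4.

THE POINT.  Node U2's `T4TwoRunUniqueness.eq_of_pin_eventualLower` ∕ `disc₀_le_of_pins` exchange the double sum of the backward recursion,
`Σ_{j<K} Σ_{i≤j} θ^{j−i}·u_i·δ_i ≤ (1−θ)⁻¹·Σ_i u_i·δ_i` — i.e. they consume `FadingMemory C θ Λ` ONLY through the COLUMN sums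
`Σ_{j≥i} Λ j i ≤ C∕(1−θ)`.  §1–§2 run that road with an arbitrary nonnegative modulus of bounded columns: pin-Lipschitz `(1 − M′U)⁻¹` and
uniqueness, K-uniform, with node U2's `U = (k₀+1)γ³ + 2γ∕b` and NOTHING ELSE of node U2's binder list changed (no sign, no two-sided bound,
no monotonicity — unlike (E32)'s row road).  §3: `FadingMemory C θ Λ ⟹` columns `≤ C∕(1−θ)` (`colSum_of_fadingMemory`), so node U2's
theorem is the geometric case of `eq_of_pin_colSum` (not re-stated: same statement).  §4: for an AGE PROFILE `Λ j i = ρ(j − i)` (the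
stationary class of `T4BetaStationary`: the modulus depends on the age only) rows and columns are both `≤ Σ_{a<n} ρ(a) ≤ M`
(`rowSum_of_profile`, `colSum_of_profile`), whence **`eq_of_pin_profile`**: `HistLipschitz (fun j i => ρ (j − i)) γ β` with a SUMMABLE
nonnegative profile (`Σ_{a<n} ρ a ≤ M` for all n — no rate, no moment), `EventualLowerH b γ k₀ β` and `M·((k₀+1)γ³ + 2γ∕b) < 1` ⟹ the tuned
bare coupling is unique and the matched history pin-Lipschitz, K-uniformly.  Census (with (E32)∕(E32b)): for the uniqueness leg the memory
enters through ONE total weight (rows along near-monotone runs = the junction's currency; columns sign-free; both = `Σ_a ρ(a)` for age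
profiles) in the product with `U`; the DECAY of the memory is idle here (it is consumed by NE4's typed GEOMETRIC rate shape `InjectedRate`
— whether the Cauchy sum's summability needs it is not decided in this station — and it IS the price of the two-loop VALUE, (E30)∕road P3).

CONTENT ([folklore]; 0 `def`, 0 sorry): §1 `colSum_fixedPoint`; §2 `disc₀_le_of_pins_colSum`, `eq_of_pin_colSum`, `disc₀_le_of_pins_colSum_eventual`,
**`eq_of_pin_colSum_eventual`**; §3 `colSum_of_fadingMemory`; §4 `rowSum_of_profile`, `colSum_of_profile`, **`eq_of_pin_profile`**,
`disc₀_le_of_pins_profile`.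
-/

noncomputable section

open Finset

namespace Summit.QuantumFields.BalabanUV.Beta.EriceRemainderEnclosureHistoryUniquenessColumn

open Literature.MathematicalPhysics.QuantumFieldTheory.Balaban1983to89
open Literature.MathematicalPhysics.QuantumFieldTheory.Balaban1983to89.FlowStep
open Literature.MathematicalPhysics.QuantumFieldTheory.Balaban1983to89.T4CouplingMatching
open Literature.MathematicalPhysics.QuantumFieldTheory.Balaban1983to89.T4TwoRunUniqueness
  (disc₀ disc₀_nonneg disc₀_pin eq_of_disc₀_eq_zero disc₀_step sum_weights₀_le_of_eventualLower)

/-! ## §1 The column-sum two-point lemma -/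

/-- Exchange of the triangular double sum: `Σ_{l<K} Σ_{i≤l} f l i = Σ_{i<K} Σ_{l∈[i,K)} f l i`. [folklore] -/
theorem sum_triangle_comm (K : ℕ) (f : ℕ → ℕ → ℝ) :
    ∑ l ∈ range K, ∑ i ∈ range (l + 1), f l i = ∑ i ∈ range K, ∑ l ∈ Ico i K, f l i := by
  refine sum_comm' fun l i => ?_
  simp only [mem_range, mem_Ico]
  omega

/-- **COLUMN-SUM TWO-POINT LEMMA** (node U2's road, decay-free).  `δ ≥ 0` with `δ_j ≤ δ_{j+1} + Σ_{i≤j} Λ j i·u_i·δ_i` (`j < K`), `Λ ≥ 0`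
with COLUMN sums `Σ_{l∈[i,K)} Λ l i ≤ M` (`i < K`), `u ≥ 0` with `Σ_{j≤K} u_j ≤ U`, `M·U < 1` ⟹ `δ_j ≤ δ_K∕(1 − M·U)` for `j ≤ K`.  NO
monotonicity of the weights. [folklore] -/
theorem colSum_fixedPoint {K : ℕ} {δ u : ℕ → ℝ} {Λ : ℕ → ℕ → ℝ} {M U d : ℝ}
    (hδ : ∀ i, 0 ≤ δ i) (hu : ∀ i, i ≤ K → 0 ≤ u i) (hΛ : ∀ j i, i ≤ j → 0 ≤ Λ j i) (hM : 0 ≤ M)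
    (hcol : ∀ i, i < K → ∑ l ∈ Ico i K, Λ l i ≤ M)
    (hU : ∑ j ∈ range (K + 1), u j ≤ U) (hsmall : M * U < 1) (hK : δ K ≤ d)
    (hrec : ∀ j, j < K → δ j ≤ δ (j + 1) + ∑ i ∈ range (j + 1), Λ j i * u i * δ i) :
    ∀ j, j ≤ K → δ j ≤ d / (1 - M * U) := by
  obtain ⟨i₀, hi₀, hmax⟩ := exists_max_image (range (K + 1)) δ ⟨0, by simp⟩
  set B := δ i₀ with hBdef
  have hB0 : 0 ≤ B := hδ i₀
  have hle : ∀ i, i ≤ K → δ i ≤ B := fun i hi => hmax i (mem_range.mpr (Nat.lt_succ_of_le hi))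
  have hU0 : 0 ≤ U := le_trans (sum_nonneg fun j hj => hu j (Nat.lt_succ_iff.mp (mem_range.mp hj))) hU
  -- the total of all increments, columns first
  have htot : ∑ l ∈ range K, ∑ i ∈ range (l + 1), Λ l i * u i * δ i ≤ M * U * B := by
    rw [sum_triangle_comm K (fun l i => Λ l i * u i * δ i)]
    calc ∑ i ∈ range K, ∑ l ∈ Ico i K, Λ l i * u i * δ i
        = ∑ i ∈ range K, (∑ l ∈ Ico i K, Λ l i) * (u i * δ i) := by
          refine sum_congr rfl fun i _ => ?_; rw [sum_mul]; exact sum_congr rfl fun l _ => by ring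
      _ ≤ ∑ i ∈ range K, M * (u i * B) := by
          refine sum_le_sum fun i hi => ?_
          have hiK : i < K := mem_range.mp hi
          exact mul_le_mul (hcol i hiK) (mul_le_mul_of_nonneg_left (hle i hiK.le) (hu i hiK.le))
            (mul_nonneg (hu i hiK.le) (hδ i)) hM
      _ = M * B * ∑ i ∈ range K, u i := by rw [mul_sum]; exact sum_congr rfl fun i _ => by ring
      _ ≤ M * B * U := by
          refine mul_le_mul_of_nonneg_left ?_ (mul_nonneg hM hB0)
          calc ∑ i ∈ range K, u i ≤ ∑ i ∈ range (K + 1), u i :=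
                sum_le_sum_of_subset_of_nonneg (range_subset_range.mpr (Nat.le_succ K))
                  (fun i hi _ => hu i (Nat.lt_succ_iff.mp (mem_range.mp hi)))
            _ ≤ U := hU
      _ = M * U * B := by ring
  have hback := backward_sum (K := K) (δ := fun j => δ j - d) (s := fun j => ∑ i ∈ range (j + 1), Λ j i * u i * δ i)
    (by show δ K - d ≤ 0; linarith)
    (fun j hj => by show δ j - d ≤ (δ (j + 1) - d) + ∑ i ∈ range (j + 1), Λ j i * u i * δ i; linarith [hrec j hj])
  have hbound : ∀ j, j ≤ K → δ j ≤ d + M * U * B := by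
    intro j hj
    have h1 := hback j hj
    have h2 : ∑ l ∈ Ico j K, ∑ i ∈ range (l + 1), Λ l i * u i * δ i ≤ ∑ l ∈ range K, ∑ i ∈ range (l + 1), Λ l i * u i * δ i :=
      sum_le_sum_of_subset_of_nonneg (fun l hl => mem_range.mpr (mem_Ico.mp hl).2) fun l hl _ =>
        sum_nonneg fun i hi => mul_nonneg (mul_nonneg (hΛ l i (Nat.lt_succ_iff.mp (mem_range.mp hi)))
          (hu i ((Nat.lt_succ_iff.mp (mem_range.mp hi)).trans (mem_range.mp hl).le))) (hδ i)
    linarith [htot]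
  have hBle : B ≤ d + M * U * B := hbound i₀ (Nat.lt_succ_iff.mp (mem_range.mp hi₀))
  have hpos : 0 < 1 - M * U := by linarith
  have hBfin : B ≤ d / (1 - M * U) := by
    rw [le_div_iff₀ hpos]
    have : B * (1 - M * U) = B - M * U * B := by ring
    linarith
  intro j hj
  exact (hle j hj).trans hBfin

/-! ## §2 Run level, sign-free: node U2's binder list with `FadingMemory` replaced by a column bound -/

/-- **PIN-LIPSCHITZ FROM COLUMN SUMS, K-UNIFORM, NO SIGN.**  Two runs of (0.20) of length `K`, same `β`, couplings in ]0,γ], under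
`HistLipschitz Λ γ β` with nonnegative moduli whose COLUMN sums are bounded (`Σ_{l∈[i,n)} Λ l i ≤ M′` for all `i < n`) and
`Σ_{i≤K}(g^A_i)² g^B_i ≤ U`: if `M′·U < 1` then `|1∕(g^A_j)² − 1∕(g^B_j)²| ≤ (1 − M′U)⁻¹·|1∕(g^A_K)² − 1∕(g^B_K)²|`, `j ≤ K`.  NO fading memory, NO
monotonicity. (`disc₀_step` BY NAME + `abs_sub_le_of_inv_sq` + `colSum_fixedPoint`.) [cite: Balaban1987RG1, (0.20) p.256 and Thm 2 p.259] -/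
theorem disc₀_le_of_pins_colSum {β : HBeta} {γ M' U : ℝ} {Λ : ℕ → ℕ → ℝ} {K : ℕ} {gA gB : ℕ → ℝ}
    (hA : RGEqH K β gA) (hB : RGEqH K β gB)
    (hAbox : ∀ i, i ≤ K → 0 < gA i ∧ gA i ≤ γ) (hBbox : ∀ i, i ≤ K → 0 < gB i ∧ gB i ≤ γ)
    (hL : HistLipschitz Λ γ β) (hΛ : ∀ k i, i ≤ k → 0 ≤ Λ k i) (hM : 0 ≤ M')
    (hcol : ∀ i n, i < n → ∑ l ∈ Ico i n, Λ l i ≤ M')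
    (hU : ∑ i ∈ range (K + 1), (gA i) ^ 2 * gB i ≤ U) (hsmall : M' * U < 1) :
    ∀ j, j ≤ K → disc₀ gA gB j ≤ disc₀ gA gB K / (1 - M' * U) := by
  refine colSum_fixedPoint (δ := disc₀ gA gB) (u := fun i => (gA i) ^ 2 * gB i) (Λ := Λ)
    (disc₀_nonneg gA gB) (fun i hi => mul_nonneg (sq_nonneg _) (hBbox i hi).1.le) hΛ hM
    (fun i hi => hcol i K hi) hU hsmall le_rfl ?_
  intro j hj
  have hstep := disc₀_step hA hB hAbox hBbox hL hj
  have hsum : ∑ i ∈ range (j + 1), Λ j i * |gA i - gB i|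
      ≤ ∑ i ∈ range (j + 1), Λ j i * ((gA i) ^ 2 * gB i) * disc₀ gA gB i := by
    refine sum_le_sum fun i hi => ?_
    have hij : i ≤ j := Nat.lt_succ_iff.mp (mem_range.mp hi)
    have hiK : i ≤ K := by omega
    have hw : |gA i - gB i| ≤ (gA i) ^ 2 * gB i * disc₀ gA gB i :=
      abs_sub_le_of_inv_sq (hAbox i hiK).1 (hBbox i hiK).1
    calc Λ j i * |gA i - gB i| ≤ Λ j i * ((gA i) ^ 2 * gB i * disc₀ gA gB i) :=
          mul_le_mul_of_nonneg_left hw (hΛ j i hij)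
      _ = Λ j i * ((gA i) ^ 2 * gB i) * disc₀ gA gB i := by ring
  linarith

/-- **UNIQUENESS FROM COLUMN SUMS, NO SIGN.**  Under the binders of `disc₀_le_of_pins_colSum`, two runs with `g^A_K = g^B_K` coincide at
every scale. [cite: Balaban1987RG1, Thm 2 p.259] -/
theorem eq_of_pin_colSum {β : HBeta} {γ M' U : ℝ} {Λ : ℕ → ℕ → ℝ} {K : ℕ} {gA gB : ℕ → ℝ}
    (hA : RGEqH K β gA) (hB : RGEqH K β gB)
    (hAbox : ∀ i, i ≤ K → 0 < gA i ∧ gA i ≤ γ) (hBbox : ∀ i, i ≤ K → 0 < gB i ∧ gB i ≤ γ)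
    (hL : HistLipschitz Λ γ β) (hΛ : ∀ k i, i ≤ k → 0 ≤ Λ k i) (hM : 0 ≤ M')
    (hcol : ∀ i n, i < n → ∑ l ∈ Ico i n, Λ l i ≤ M')
    (hU : ∑ i ∈ range (K + 1), (gA i) ^ 2 * gB i ≤ U) (hsmall : M' * U < 1) (hpin : gA K = gB K) :
    ∀ j, j ≤ K → gA j = gB j := by
  intro j hj
  have h := disc₀_le_of_pins_colSum hA hB hAbox hBbox hL hΛ hM hcol hU hsmall j hj
  rw [disc₀_pin hpin, zero_div] at h
  exact eq_of_disc₀_eq_zero (hAbox j hj).1 (hBbox j hj).1 (le_antisymm h (disc₀_nonneg _ _ _))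

/-- **PIN-LIPSCHITZ, COLUMN FORM WITH NODE U2's U.**  Node U2's binder list of `T4TwoRunUniqueness.disc₀_le_of_pins` ∕ `eq_of_pin_eventualLower`
with `FadingMemory C θ Λ` REPLACED by «columns ≤ M′» (nothing else added): `EventualLowerH b γ k₀ β` (`b > 0`) gives
`U = (k₀+1)γ³ + 2γ∕b` (`sum_weights₀_le_of_eventualLower` BY NAME), and `M′·((k₀+1)γ³ + 2γ∕b) < 1` ⟹ pin-Lipschitz with the K-uniform constant
`(1 − M′((k₀+1)γ³ + 2γ∕b))⁻¹`. [cite: Balaban1987RG1, (0.20) p.256, Thm 2 p.259, (0.31) p.259] -/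
theorem disc₀_le_of_pins_colSum_eventual {β : HBeta} {γ b M' : ℝ} {k₀ : ℕ} {Λ : ℕ → ℕ → ℝ} {K : ℕ} {gA gB : ℕ → ℝ}
    (hb : 0 < b) (hA : RGEqH K β gA) (hB : RGEqH K β gB)
    (hAbox : ∀ i, i ≤ K → 0 < gA i ∧ gA i ≤ γ) (hBbox : ∀ i, i ≤ K → 0 < gB i ∧ gB i ≤ γ)
    (hL : HistLipschitz Λ γ β) (hΛ : ∀ k i, i ≤ k → 0 ≤ Λ k i) (hM : 0 ≤ M')
    (hcol : ∀ i n, i < n → ∑ l ∈ Ico i n, Λ l i ≤ M') (hlo : EventualLowerH b γ k₀ β)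
    (hsmall : M' * (((k₀ : ℝ) + 1) * γ ^ 3 + 2 * γ / b) < 1) :
    ∀ j, j ≤ K → disc₀ gA gB j ≤ disc₀ gA gB K / (1 - M' * (((k₀ : ℝ) + 1) * γ ^ 3 + 2 * γ / b)) :=
  have hγ : 0 < γ := (hAbox 0 (Nat.zero_le _)).1.trans_le (hAbox 0 (Nat.zero_le _)).2
  disc₀_le_of_pins_colSum hA hB hAbox hBbox hL hΛ hM hcol (sum_weights₀_le_of_eventualLower hγ hb hA hB hAbox hBbox hlo) hsmall

/-- **UNIQUENESS OF THE TUNED BARE COUPLING, COLUMN FORM — node U2's theorem with `FadingMemory` replaced by a column bound, NO SIGN, NO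
DECAY.** [cite: Balaban1987RG1, Thm 2 p.259] -/
theorem eq_of_pin_colSum_eventual {β : HBeta} {γ b M' : ℝ} {k₀ : ℕ} {Λ : ℕ → ℕ → ℝ} {K : ℕ} {gA gB : ℕ → ℝ}
    (hb : 0 < b) (hA : RGEqH K β gA) (hB : RGEqH K β gB)
    (hAbox : ∀ i, i ≤ K → 0 < gA i ∧ gA i ≤ γ) (hBbox : ∀ i, i ≤ K → 0 < gB i ∧ gB i ≤ γ)
    (hL : HistLipschitz Λ γ β) (hΛ : ∀ k i, i ≤ k → 0 ≤ Λ k i) (hM : 0 ≤ M')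
    (hcol : ∀ i n, i < n → ∑ l ∈ Ico i n, Λ l i ≤ M') (hlo : EventualLowerH b γ k₀ β)
    (hsmall : M' * (((k₀ : ℝ) + 1) * γ ^ 3 + 2 * γ / b) < 1) (hpin : gA K = gB K) :
    ∀ j, j ≤ K → gA j = gB j := by
  intro j hj
  have h := disc₀_le_of_pins_colSum_eventual hb hA hB hAbox hBbox hL hΛ hM hcol hlo hsmall j hj
  rw [disc₀_pin hpin, zero_div] at h
  exact eq_of_disc₀_eq_zero (hAbox j hj).1 (hBbox j hj).1 (le_antisymm h (disc₀_nonneg _ _ _))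

/-! ## §3 Node U2's geometric class has bounded columns -/

/-- `FadingMemory C θ Λ` (`0 ≤ θ < 1`) ⟹ COLUMN sums `Σ_{l∈[i,n)} Λ l i ≤ C∕(1−θ)` — so node U2's `eq_of_pin_eventualLower` (smallness
`C·U < 1 − θ`, i.e. `(C∕(1−θ))·U < 1`) is the geometric case of `eq_of_pin_colSum_eventual` (same statement; not re-declared). [folklore] -/
theorem colSum_of_fadingMemory {C θ : ℝ} {Λ : ℕ → ℕ → ℝ} (hθ0 : 0 ≤ θ) (hθ1 : θ < 1) (hΛ : FadingMemory C θ Λ)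
    (i n : ℕ) : ∑ l ∈ Ico i n, Λ l i ≤ C / (1 - θ) := by
  have hC : 0 ≤ C := by have h := (hΛ 0 0 le_rfl); simpa using h.1.trans h.2
  calc ∑ l ∈ Ico i n, Λ l i ≤ ∑ l ∈ Ico i n, C * θ ^ (l - i) :=
        sum_le_sum fun l hl => (hΛ l i (mem_Ico.mp hl).1).2
    _ = C * ∑ m ∈ range (n - i), θ ^ m := by
        rw [mul_sum, sum_Ico_eq_sum_range]
        exact sum_congr rfl fun m _ => by rw [show i + m - i = m by omega]
    _ ≤ C * (1 / (1 - θ)) := by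
        refine mul_le_mul_of_nonneg_left ?_ hC
        rw [le_div_iff₀ (by linarith : 0 < 1 - θ), geom_sum_mul_neg]; linarith [pow_nonneg hθ0 (n - i)]
    _ = C / (1 - θ) := by ring

/-! ## §4 Age profiles: rows = columns = the profile's total weight; a SUMMABLE profile pays uniqueness -/

/-- For an AGE PROFILE `Λ j i = ρ(j − i)` with `ρ ≥ 0` and partial sums `Σ_{a<n} ρ a ≤ M`: ROW total weight `≤ M`. [folklore] -/
theorem rowSum_of_profile {ρ : ℕ → ℝ} {M : ℝ} (hρM : ∀ n, ∑ a ∈ range n, ρ a ≤ M) (k : ℕ) :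
    ∑ i ∈ range (k + 1), ρ (k - i) ≤ M := by
  have e : ∑ i ∈ range (k + 1), ρ (k - i) = ∑ a ∈ range (k + 1), ρ a := by
    rw [← sum_range_reflect (fun a => ρ a) (k + 1)]
    exact sum_congr rfl fun i _ => by rw [show k + 1 - 1 - i = k - i by omega]
  rw [e]; exact hρM (k + 1)

/-- For an AGE PROFILE: COLUMN total weight `Σ_{l∈[i,n)} ρ(l − i) = Σ_{a<n−i} ρ a ≤ M`. [folklore] -/
theorem colSum_of_profile {ρ : ℕ → ℝ} {M : ℝ} (hρM : ∀ n, ∑ a ∈ range n, ρ a ≤ M) (i n : ℕ) :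
    ∑ l ∈ Ico i n, ρ (l - i) ≤ M := by
  rw [sum_Ico_eq_sum_range]
  calc ∑ m ∈ range (n - i), ρ (i + m - i) = ∑ m ∈ range (n - i), ρ m :=
        sum_congr rfl fun m _ => by rw [show i + m - i = m by omega]
    _ ≤ M := hρM _

/-- **A SUMMABLE AGE PROFILE PAYS THE UNIQUENESS LEG — NO RATE, NO SIGN.**  Two runs of (0.20) of length `K` in ]0,γ], same `β`, under
`HistLipschitz (fun j i => ρ (j − i)) γ β` with a nonnegative profile of bounded partial sums `Σ_{a<n} ρ a ≤ M` (all `n`), the floor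
`EventualLowerH b γ k₀ β` (`b > 0`) and `M·((k₀+1)γ³ + 2γ∕b) < 1`: pinned at the same `g_K`, they COINCIDE at every scale, K-uniformly.
Node U2's `FadingMemory C θ` is the profile `ρ a = Cθ^a` (`M = C∕(1−θ)`); here ANY summable profile does, e.g. `ρ a = c∕(1+a)²`, for which no
`FadingMemory C θ` with `θ < 1` holds. [cite: Balaban1987RG1, Thm 2 p.259] -/
theorem eq_of_pin_profile {β : HBeta} {γ b M : ℝ} {k₀ : ℕ} {ρ : ℕ → ℝ} {K : ℕ} {gA gB : ℕ → ℝ}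
    (hb : 0 < b) (hA : RGEqH K β gA) (hB : RGEqH K β gB)
    (hAbox : ∀ i, i ≤ K → 0 < gA i ∧ gA i ≤ γ) (hBbox : ∀ i, i ≤ K → 0 < gB i ∧ gB i ≤ γ)
    (hL : HistLipschitz (fun j i => ρ (j - i)) γ β) (hρ : ∀ a, 0 ≤ ρ a) (hρM : ∀ n, ∑ a ∈ range n, ρ a ≤ M)
    (hlo : EventualLowerH b γ k₀ β) (hsmall : M * (((k₀ : ℝ) + 1) * γ ^ 3 + 2 * γ / b) < 1) (hpin : gA K = gB K) :
    ∀ j, j ≤ K → gA j = gB j :=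
  eq_of_pin_colSum_eventual hb hA hB hAbox hBbox hL (fun _ _ _ => hρ _) ((sum_nonneg fun a _ => hρ a).trans (hρM 1))
    (fun i n _ => colSum_of_profile hρM i n) hlo hsmall hpin

/-- Pin-Lipschitz form of `eq_of_pin_profile` (K-uniform constant `(1 − M((k₀+1)γ³ + 2γ∕b))⁻¹`). [cite: Balaban1987RG1, Thm 2 p.259] -/
theorem disc₀_le_of_pins_profile {β : HBeta} {γ b M : ℝ} {k₀ : ℕ} {ρ : ℕ → ℝ} {K : ℕ} {gA gB : ℕ → ℝ}
    (hb : 0 < b) (hA : RGEqH K β gA) (hB : RGEqH K β gB)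
    (hAbox : ∀ i, i ≤ K → 0 < gA i ∧ gA i ≤ γ) (hBbox : ∀ i, i ≤ K → 0 < gB i ∧ gB i ≤ γ)
    (hL : HistLipschitz (fun j i => ρ (j - i)) γ β) (hρ : ∀ a, 0 ≤ ρ a) (hρM : ∀ n, ∑ a ∈ range n, ρ a ≤ M)
    (hlo : EventualLowerH b γ k₀ β) (hsmall : M * (((k₀ : ℝ) + 1) * γ ^ 3 + 2 * γ / b) < 1) :
    ∀ j, j ≤ K → disc₀ gA gB j ≤ disc₀ gA gB K / (1 - M * (((k₀ : ℝ) + 1) * γ ^ 3 + 2 * γ / b)) :=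
  disc₀_le_of_pins_colSum_eventual hb hA hB hAbox hBbox hL (fun _ _ _ => hρ _) ((sum_nonneg fun a _ => hρ a).trans (hρM 1))
    (fun i n _ => colSum_of_profile hρM i n) hlo hsmall

end Summit.QuantumFields.BalabanUV.Beta.EriceRemainderEnclosureHistoryUniquenessColumn

end
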